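import Mathlib.GroupTheory.PGroup
import Mathlib.GroupTheory.SpecificGroups.Cyclic
import Summits.MatrixMultiplication.OmegaCensus.BoxUsefulSections
import Summits.MatrixMultiplication.OmegaCensus.CentreIndexFourGroups
import Summits.MatrixMultiplication.OmegaCensus.BoxBadDerivedTwo
import Summits.MatrixMultiplication.OmegaCensus.BoxBadDerivedFour
import Summits.MatrixMultiplication.OmegaCensus.BoxBadOrderFourCommutator
import Summits.MatrixMultiplication.OmegaCensus.BoxBadClass3Config

/-!
# ω-census, family (b3): conjecture C9 (b) HOLDS on every finite `2`-group

HONEST FRAMING (pub-omega census; verbatim): lottery ticket; floor = certified bounds/negative ranges.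
Census BOOKKEEPING (conjecture C9 of the cell, STRUCTURE.md §2; pub-omega kernel-l4 gen 15, task K-4 — the `p = 2` companion of
`BoxBadOddPGroups`).  **`index_center_le_four_of_isPGroup_two`: a box-useful finite `2`-group has centre of index `≤ 4`** — exactly what
`BoxRatioSectionLaw` (b) predicts for `2`-groups (index `1` or `4`; index `2` is impossible for any group).  Proof = the blueprint of the
seat memo K4 §9b: strong induction on `|G|`; for a central involution `z` the quotient `G ⧸ ⟨z⟩` is box-useful (`BoxUseful.quotient`), so by
induction its centre has index `≤ 4`, whence (`CentreIndexFour.exists_smallComm`, or abelian) all its commutators lie in `{1, w}`; lifting,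
every commutator VALUE of `G` lies in `{1, z, c, cz}` with `c² ∈ {1, z}`.  Then: values in `{1, z}` or `{1, c}` ⇒ `BoxBadDerivedTwo`;
`c` central of order `4` ⇒ `BoxBadOrderFourCommutator`; `c` central involution with a second value ⇒ `BoxBadDerivedFour`; `c` not central
⇒ `BoxBadClass3Config` (⇒ `BoxBadClass3A/B`).  Every ingredient is a uniform, decide-free theorem of this programme.  Corollary
`boxRatioSectionLaw_of_isPGroup_two`.  Nothing here is progress on `ω`.
-/

namespace Summit.MatrixMultiplication.OmegaCensus

open Finset ProductBoxBound

namespace TwoGroup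

universe u

/-- A group whose centre has prime index is abelian (so this never happens). [folklore] -/
theorem comm_of_index_center_prime {Q : Type*} [Group Q] {p : ℕ} [Fact p.Prime] (e : (Subgroup.center Q).index = p)
    (x y : Q) : x * y = y * x := by
  haveI : IsCyclic (Q ⧸ Subgroup.center Q) := isCyclic_of_prime_card (p := p) (by rw [← Subgroup.index_eq_card, e])
  have hc := MonoidHom.isMulCommutative_of_isCyclic_of_ker_le_center (QuotientGroup.mk' (Subgroup.center Q))
    (by rw [QuotientGroup.ker_mk'])
  exact hc.is_comm.comm x y

/-- From `SmallComm z`: `z` is central. [folklore] -/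
theorem central_of_smallComm {Q : Type*} [Group Q] {z : Q} (h : CentreIndexFour.SmallComm z) (g : Q) : g * z = z * g := by
  rcases h.2.2.1 g z with e | e
  · exact e
  · exfalso; apply h.1
    calc z = (z * g)⁻¹ * (z * g * z) := by group
      _ = (z * g)⁻¹ * (g * z) := by rw [← e]
      _ = 1 := by
          rcases h.2.2.1 g z with e' | e'
          · rw [e']; group
          · have : g = z * g := by
              calc g = g * z * z := by rw [mul_assoc, h.2.1, mul_one]
                _ = z * g * z * z := by rw [← e']
                _ = z * g := by rw [mul_assoc (z * g), h.2.1, mul_one]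
            exact absurd (by calc z = z * g * g⁻¹ := by group
                                  _ = 1 := by rw [← this]; group) h.1

/-- A group whose centre has index `≤ 4` has all commutators in `{1, w}` for some `w` with `w² = 1`. [folklore] -/
theorem exists_comm_values_of_index_le_four {Q : Type*} [Group Q] [Finite Q] (h4 : (Subgroup.center Q).index ≤ 4) :
    ∃ w : Q, w * w = 1 ∧ ∀ a b : Q, a * b * a⁻¹ * b⁻¹ = 1 ∨ a * b * a⁻¹ * b⁻¹ = w := by
  by_cases h : (Subgroup.center Q).index = 4
  · obtain ⟨z, hz⟩ := CentreIndexFour.exists_smallComm h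
    refine ⟨z, hz.2.1, fun a b => ?_⟩
    rcases hz.2.2.1 a b with e | e
    · left; rw [e]; group
    · right
      calc a * b * a⁻¹ * b⁻¹ = b * a * z * a⁻¹ * b⁻¹ := by rw [e]
        _ = b * a * (a⁻¹ * z) * b⁻¹ := by rw [central_of_smallComm hz a⁻¹]; group
        _ = b * z * b⁻¹ := by group
        _ = z := by rw [mul_assoc, ← central_of_smallComm hz b⁻¹]; group
  · -- index `1`, `2` or `3`: the central quotient is cyclic, so `Q` is abelian
    refine ⟨1, mul_one 1, fun a b => Or.inl ?_⟩
    have hidx : (Subgroup.center Q).index = 1 ∨ (Subgroup.center Q).index = 2 ∨ (Subgroup.center Q).index = 3 := by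
      have hpos : 0 < (Subgroup.center Q).index := Nat.pos_of_ne_zero Subgroup.index_ne_zero_of_finite
      omega
    have comm : ∀ x y : Q, x * y = y * x := by
      rcases hidx with e | e | e
      · intro x y
        have hx : x ∈ Subgroup.center Q := by rw [Subgroup.index_eq_one.mp e]; exact Subgroup.mem_top x
        exact ((Subgroup.mem_center_iff.mp hx) y).symm
      · haveI : Fact (Nat.Prime 2) := ⟨Nat.prime_two⟩
        exact comm_of_index_center_prime e
      · haveI : Fact (Nat.Prime 3) := ⟨Nat.prime_three⟩
        exact comm_of_index_center_prime e
    rw [comm a b]; group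

/-- A non-trivial central element of a `2`-group yields a central involution. [folklore] -/
theorem exists_central_involution {G : Type*} [Group G] (hG : IsPGroup 2 G) {g : G} (hg : g ∈ Subgroup.center G) (hg1 : g ≠ 1) :
    ∃ z : G, z ∈ Subgroup.center G ∧ z ≠ 1 ∧ z * z = 1 := by
  classical
  obtain ⟨k, hk⟩ := hG g
  have hex : ∃ j : ℕ, g ^ (2 ^ j) = 1 := ⟨k, hk⟩
  let j := Nat.find hex
  have hj : g ^ (2 ^ j) = 1 := Nat.find_spec hex
  have hj0 : j ≠ 0 := by
    intro e; apply hg1; rw [← pow_one g, ← pow_zero 2, ← e]; exact hj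
  obtain ⟨i, hi⟩ : ∃ i, j = i + 1 := ⟨j - 1, by omega⟩
  refine ⟨g ^ (2 ^ i), Subgroup.pow_mem _ hg _, ?_, ?_⟩
  · have := Nat.find_min hex (show i < j by omega)
    exact this
  · rw [← pow_add, ← two_mul, ← pow_succ', ← hi]; exact hj

/-- The induction: every box-useful `2`-group of order `n` has centre of index `≤ 4`. [folklore] -/
theorem index_center_le_four_card (n : ℕ) :
    ∀ (G : Type u) [Group G] [Fintype G] [DecidableEq G], Fintype.card G = n → IsPGroup 2 G → BoxUseful G →
      (Subgroup.center G).index ≤ 4 := by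
  induction n using Nat.strong_induction_on with
  | _ n ih =>
    intro G _ _ _ hcard hG hgood
    classical
    by_contra hbig
    push Not at hbig
    -- `G` is not abelian, so its centre is a non-trivial `2`-group: pick a central involution `z`
    have hna : ∃ a b : G, a * b ≠ b * a := by
      by_contra! hall
      have htop : Subgroup.center G = ⊤ := by
        rw [Subgroup.eq_top_iff']; intro x; rw [Subgroup.mem_center_iff]; intro g; exact hall g x
      rw [htop, Subgroup.index_top] at hbig; omega
    obtain ⟨a₀, b₀, hab₀⟩ := hna
    haveI : Nontrivial G := ⟨⟨a₀ * b₀, b₀ * a₀, hab₀⟩⟩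
    haveI : Fact (Nat.Prime 2) := ⟨Nat.prime_two⟩
    have hZ : Nontrivial (Subgroup.center G) := hG.center_nontrivial
    obtain ⟨⟨g, hg⟩, hg1⟩ := exists_ne (1 : Subgroup.center G)
    have hg1' : g ≠ 1 := fun e => hg1 (Subtype.ext e)
    obtain ⟨z, hz, hz1, hzz⟩ := exists_central_involution hG hg hg1'
    have zc : ∀ t : G, t * z = z * t := fun t => Subgroup.mem_center_iff.mp hz t
    have iz : z⁻¹ = z := by rw [inv_eq_iff_mul_eq_one, hzz]
    -- the normal subgroup `N = {1, z}`
    let N : Subgroup G :=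
      { carrier := {x | x = 1 ∨ x = z}
        mul_mem' := by
          intro a b ha hb
          simp only [Set.mem_setOf_eq] at ha hb ⊢
          rcases ha with ha | ha <;> rcases hb with hb | hb <;> rw [ha, hb]
          · exact Or.inl (mul_one 1)
          · exact Or.inr (one_mul z)
          · exact Or.inr (mul_one z)
          · exact Or.inl hzz
        one_mem' := Or.inl rfl
        inv_mem' := by
          intro a ha
          simp only [Set.mem_setOf_eq] at ha ⊢
          rcases ha with ha | ha <;> rw [ha]
          · exact Or.inl inv_one
          · exact Or.inr iz }
    have memN : ∀ x : G, x ∈ N ↔ x = 1 ∨ x = z := fun x => Iff.rfl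
    haveI hN : N.Normal := ⟨fun n hn g => by
      rcases (memN n).1 hn with hn' | hn' <;> rw [hn']
      · rw [mul_one, mul_inv_cancel]; exact N.one_mem
      · rw [(memN _)]; right; rw [zc g, mul_inv_cancel_right]⟩
    have hNbot : N ≠ ⊥ := by
      intro e; apply hz1
      have : z ∈ N := (memN z).2 (Or.inr rfl)
      rw [e] at this; exact Subgroup.mem_bot.mp this
    haveI : Fintype (G ⧸ N) := Fintype.ofFinite _
    have hlt : Fintype.card (G ⧸ N) < n := by
      rw [← hcard, ← Nat.card_eq_fintype_card, ← Nat.card_eq_fintype_card, Subgroup.card_eq_card_quotient_mul_card_subgroup N]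
      have h1 : 1 < Nat.card N := (Subgroup.one_lt_card_iff_ne_bot N).mpr hNbot
      have h2 : 0 < Nat.card (G ⧸ N) := Nat.card_pos
      nlinarith
    -- induction hypothesis on the quotient, and the shape of its commutators
    have hQ := ih _ hlt (G ⧸ N) rfl (hG.to_quotient N) (hgood.quotient N)
    obtain ⟨w, hww, hw⟩ := exists_comm_values_of_index_le_four hQ
    obtain ⟨c, hc⟩ := QuotientGroup.mk_surjective w
    -- lift: every commutator value of `G` lies in `{1, z, c, cz}`
    have lift : ∀ x y : G, (x : G ⧸ N) = (y : G ⧸ N) → y = x ∨ y = x * z := by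
      intro x y e
      rcases (memN _).1 (QuotientGroup.eq.1 e) with e' | e'
      · left; calc y = x * (x⁻¹ * y) := by group
          _ = x := by rw [e', mul_one]
      · right; calc y = x * (x⁻¹ * y) := by group
          _ = x * z := by rw [e']
    have hvals : ∀ a b : G, a * b * a⁻¹ * b⁻¹ = 1 ∨ a * b * a⁻¹ * b⁻¹ = z ∨ a * b * a⁻¹ * b⁻¹ = c ∨
        a * b * a⁻¹ * b⁻¹ = c * z := by
      intro a b
      have him : ((a * b * a⁻¹ * b⁻¹ : G) : G ⧸ N) = (a : G ⧸ N) * (b : G ⧸ N) * (a : G ⧸ N)⁻¹ * (b : G ⧸ N)⁻¹ := by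
        simp only [QuotientGroup.mk_mul, QuotientGroup.mk_inv]
      rcases hw (a : G ⧸ N) (b : G ⧸ N) with e | e
      · rcases lift 1 (a * b * a⁻¹ * b⁻¹) (by rw [him, e, QuotientGroup.mk_one]) with e' | e'
        · exact Or.inl e'
        · exact Or.inr (Or.inl (by rw [e', one_mul]))
      · rcases lift c (a * b * a⁻¹ * b⁻¹) (by rw [him, e, hc]) with e' | e'
        · exact Or.inr (Or.inr (Or.inl e'))
        · exact Or.inr (Or.inr (Or.inr e'))
    have hc2 : c * c = 1 ∨ c * c = z := by
      rcases lift 1 (c * c) (by rw [QuotientGroup.mk_mul, hc, hww, QuotientGroup.mk_one]) with e | e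
      · exact Or.inl e
      · exact Or.inr (by rw [e, one_mul])
    -- case A: all values in `{1, z}`
    by_cases hA : ∀ a b : G, a * b * a⁻¹ * b⁻¹ = 1 ∨ a * b * a⁻¹ * b⁻¹ = z
    · exact absurd (CommPairs.index_center_le_four_of_boxUseful hA hgood) (by omega)
    push Not at hA
    obtain ⟨a, b, hab1, habz⟩ := hA
    -- `c₀ := [a, b] ∈ {c, cz}`; re-centre the value set at `c₀`
    set c₀ := a * b * a⁻¹ * b⁻¹ with hc₀
    have hc₀ : c₀ = c ∨ c₀ = c * z := by
      rcases hvals a b with e | e | e | e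
      · exact absurd e hab1
      · exact absurd e habz
      · exact Or.inl e
      · exact Or.inr e
    have hvals₀ : ∀ x y : G, x * y * x⁻¹ * y⁻¹ = 1 ∨ x * y * x⁻¹ * y⁻¹ = z ∨ x * y * x⁻¹ * y⁻¹ = c₀ ∨
        x * y * x⁻¹ * y⁻¹ = c₀ * z := by
      intro x y
      rcases hc₀ with e0 | e0
      · rw [e0]; exact hvals x y
      · rcases hvals x y with e | e | e | e
        · exact Or.inl e
        · exact Or.inr (Or.inl e)
        · right; right; right; rw [e, e0, mul_assoc, hzz, mul_one]
        · right; right; left; rw [e, e0]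
    have hc₀2 : c₀ * c₀ = 1 ∨ c₀ * c₀ = z := by
      have : c₀ * c₀ = c * c := by
        rcases hc₀ with e0 | e0
        · rw [e0]
        · rw [e0]
          calc c * z * (c * z) = c * (z * c) * z := by group
            _ = c * (c * z) * z := by rw [← zc c]
            _ = c * c := by rw [mul_assoc, mul_assoc, hzz, mul_one]
      rw [this]; exact hc2
    -- case B: `c₀` is not central ⇒ class-`3` configuration
    by_cases hB : ∃ m : G, m * c₀ ≠ c₀ * m
    · exact CommPairs.not_boxUseful_of_class3_values hz hz1 hzz hvals₀ rfl hB hc₀2 hgood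
    push Not at hB
    have hcen : c₀ ∈ Subgroup.center G := Subgroup.mem_center_iff.mpr fun m => hB m
    -- case C: `c₀` central of order `4`
    rcases hc₀2 with hsq | hsq
    swap
    · refine CommPairs.not_boxUseful_of_comm4 rfl hcen (by rw [hsq]; exact hz1) ?_ hgood
      calc c₀ * (c₀ * (c₀ * c₀)) = (c₀ * c₀) * (c₀ * c₀) := by group
        _ = 1 := by rw [hsq, hzz]
    -- case D: `c₀` a central involution; look for a second value
    have h0z : c₀ ≠ z := habz
    have h01 : c₀ ≠ 1 := hab1
    by_cases hD : ∃ x y : G, x * y * x⁻¹ * y⁻¹ = z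
    · obtain ⟨x, y, hxy⟩ := hD
      have hcomm : ∀ s t : G, s * t * s⁻¹ * t⁻¹ = 1 ∨ s * t * s⁻¹ * t⁻¹ = c₀ ∨ s * t * s⁻¹ * t⁻¹ = z ∨
          s * t * s⁻¹ * t⁻¹ = c₀ * z := by
        intro s t; rcases hvals₀ s t with e | e | e | e
        · exact Or.inl e
        · exact Or.inr (Or.inr (Or.inl e))
        · exact Or.inr (Or.inl e)
        · exact Or.inr (Or.inr (Or.inr e))
      exact CommPairs.not_boxUseful_of_comm_four hcomm hcen hz hsq hzz h0z h01 hz1 rfl hxy hgood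
    push Not at hD
    by_cases hE : ∃ x y : G, x * y * x⁻¹ * y⁻¹ = c₀ * z
    · obtain ⟨x, y, hxy⟩ := hE
      have hz0z : c₀ * z ∈ Subgroup.center G := Subgroup.mul_mem _ hcen hz
      have h1 : c₀ * z ≠ 1 := by
        intro e; apply h0z
        calc c₀ = c₀ * z * z := by rw [mul_assoc, hzz, mul_one]
          _ = z := by rw [e, one_mul]
      have h2 : c₀ ≠ c₀ * z := by
        intro e; apply hz1
        calc z = c₀⁻¹ * (c₀ * z) := by group
          _ = 1 := by rw [← e]; group
      have h3 : (c₀ * z) * (c₀ * z) = 1 := by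
        calc c₀ * z * (c₀ * z) = c₀ * (z * c₀) * z := by group
          _ = c₀ * (c₀ * z) * z := by rw [← zc c₀]
          _ = 1 := by rw [← mul_assoc, hsq, one_mul, hzz]
      have hcomm : ∀ s t : G, s * t * s⁻¹ * t⁻¹ = 1 ∨ s * t * s⁻¹ * t⁻¹ = c₀ ∨ s * t * s⁻¹ * t⁻¹ = c₀ * z ∨
          s * t * s⁻¹ * t⁻¹ = c₀ * (c₀ * z) := by
        intro s t; rcases hvals₀ s t with e | e | e | e
        · exact Or.inl e
        · right; right; right; rw [e, ← mul_assoc, hsq, one_mul]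
        · exact Or.inr (Or.inl e)
        · exact Or.inr (Or.inr (Or.inl e))
      exact CommPairs.not_boxUseful_of_comm_four hcomm hcen hz0z hsq h3 h2 h01 h1 rfl hxy hgood
    push Not at hE
    -- case E: all values in `{1, c₀}`
    have hF : ∀ s t : G, s * t * s⁻¹ * t⁻¹ = 1 ∨ s * t * s⁻¹ * t⁻¹ = c₀ := by
      intro s t; rcases hvals₀ s t with e | e | e | e
      · exact Or.inl e
      · exact absurd e (hD s t)
      · exact Or.inr e
      · exact absurd e (hE s t)
    exact absurd (CommPairs.index_center_le_four_of_boxUseful hF hgood) (by omega)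

/-- **C9 (b) holds on every finite `2`-group**: a box-useful one has centre of index at most `4`. [folklore] -/
theorem index_center_le_four_of_isPGroup_two {G : Type u} [Group G] [Fintype G] [DecidableEq G] (hG : IsPGroup 2 G)
    (h : BoxUseful G) : (Subgroup.center G).index ≤ 4 :=
  index_center_le_four_card (Fintype.card G) G rfl hG h

/-- **C9 (b) in the shape of `BoxRatioSectionLaw`** for `2`-groups (same disjunction as `boxRatioSectionLaw_of_isPGroup_odd`) — in fact
index `1` or `4` (index `2`, `3` are impossible for any group). [folklore] -/
theorem boxRatioSectionLaw_of_isPGroup_two {G : Type u} [Group G] [Fintype G] [DecidableEq G] (hG : IsPGroup 2 G)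
    (h : BoxUseful G) :
    (Subgroup.center G).index = 1 ∨ (Subgroup.center G).index = 4 ∨ (Subgroup.center G).index = 6 ∨
      ∃ (c₁ c₂ : G) (κ₁ κ₂ ε : G → ZMod 3), DihC3Sq.Coord2 c₁ c₂ κ₁ κ₂ ε := by
  have h4 := index_center_le_four_of_isPGroup_two hG h
  have hpos : 0 < (Subgroup.center G).index := Nat.pos_of_ne_zero Subgroup.index_ne_zero_of_finite
  -- index `2` or `3` would make `G ⧸ Z(G)` cyclic, hence `G` abelian, hence index `1`
  by_cases h1 : (Subgroup.center G).index = 1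
  · exact Or.inl h1
  by_cases h4' : (Subgroup.center G).index = 4
  · exact Or.inr (Or.inl h4')
  exfalso
  have h23 : (Subgroup.center G).index = 2 ∨ (Subgroup.center G).index = 3 := by omega
  have comm : ∀ x y : G, x * y = y * x := by
    rcases h23 with e | e
    · haveI : Fact (Nat.Prime 2) := ⟨Nat.prime_two⟩
      exact comm_of_index_center_prime e
    · haveI : Fact (Nat.Prime 3) := ⟨Nat.prime_three⟩
      exact comm_of_index_center_prime e
  apply h1
  rw [Subgroup.index_eq_one, eq_top_iff]
  intro x _
  rw [Subgroup.mem_center_iff]; intro g; exact comm g x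

end TwoGroup

end Summit.MatrixMultiplication.OmegaCensus
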